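import Literature.AnabelianGeometry.SemiGraphs.Prop36HypothesesWitness
import Literature.AnabelianGeometry.SemiGraphs.BTempResEquiv
import Literature.AnabelianGeometry.SemiGraphs.TemperoidsResProofs

/-!
# An explicit tempered fundamental group chart of the Prop. 3.6 / Thm. 3.7 witness: `π₁^temp = Aff(ℤ_p)`

Mochizuki, *Semi-graphs of anabelioids*, Publ. RIMS **42** (2006) [MochizukiSemiAnbd2006], §3:
`B^cov(G)` / `B^temp(G)` and tempered coverings, Def. 3.5 (i)(ii) p. 261 (kurims p. 37); the
tempered fundamental group and `B^temp(π₁^temp(G)) ⥲ B^temp(G)`, Prop. 3.6 (ii) p. 262 (kurims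
p. 38); verticial subgroups, Thm. 3.7 (i) p. 264 (kurims p. 40).

Companion of `Prop36HypothesesWitness.lean` (cell abc-iut, layer L3, row WIT-1a/WIT-1c; seat
abc-iut-w5-d212).  For the witness `affWitness p` — ONE vertex with anabelioid `B(Aff(ℤ_p))`, NO
edges — a covering (an object of `B^cov`) is nothing but its `Aff(ℤ_p)`-set at the vertex, and
EVERY covering is tempered: the stabiliser of a point is open, so contains a congruence subgroup
`Γ_n`, which is normal and therefore fixes the whole orbit ( = connected component) of the point;
the finite covering `Aff(ℤ_p)/Γ_n` then splits that component.  Hence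
`B^temp(affWitness p) ≌ B^temp(Aff(ℤ_p))` by `S ↦ S_v` (`affTemperedEquiv`), and the witness carries
the EXPLICIT chart `affChart p` whose group is `Aff(ℤ_p)` on the nose (no appeal to the general
existence theorem `ExistsTemperedPiChart_holds`).  For this chart the identity of `Aff(ℤ_p)` is a
verticial homomorphism, so the whole group `⊤` is a verticial subgroup
(`top_mem_verticialSubgroups_affChart`); conversely, by Prop. 3.2 (injectivity half, the tree's
`ResIsoResIff_holds`) every verticial homomorphism is an inner automorphism, so the verticial
subgroups at the vertex are EXACTLY `{⊤}` (`verticialSubgroups_affChart_eq`).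
This makes the Thm. 3.7 vocabulary COMPUTABLE at the witness and is the chart over which the
repaired level dictionary `CovLevelDictionary` is instantiated (sequel).  A witness certifies
non-vacuity / consistency only; no statement of the paper is touched, strengthened or assumed.
Nothing here takes a side on [IUTchIII] Cor. 3.12.
-/

noncomputable section

namespace Literature.AnabelianGeometry.SemiGraphs

namespace ProfiniteSemiGraph

open CategoryTheory Topology Literature.GroupTheory.SpecificGroups
open Literature.AlgebraicGeometry.Frobenioids.QuasiTemperoid.BTempConnected
  (hom_ext_apply ρ_one_apply ρ_mul_apply)

universe u

variable {p : ℕ} [Fact p.Prime]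

/-! ### Coverings of the witness are `Aff(ℤ_p)`-sets -/

/-- The covering of the witness with vertex fibre `X` (there are no edges to glue).
[cite: MochizukiSemiAnbd2006, Def 3.5(i) p.37] -/
def affCovObj (X : BTemp (PadicAffine p)) : CovObj (affWitness p) where
  SV := fun _ => X
  SE := fun e => nomatch e
  glue := fun b => nomatch b

/-- Every covering of the witness is the covering with its own vertex fibre.
[cite: MochizukiSemiAnbd2006, Def 3.5(i) p.37] -/
theorem affCovObj_SV (S : CovObj (affWitness p)) : affCovObj (S.SV PUnit.unit) = S := by
  obtain ⟨SV, SE, glue⟩ := S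
  have hSE : SE = fun e => nomatch e := funext fun e => nomatch e
  subst hSE
  have hglue : glue = fun b => nomatch b := funext fun b => nomatch b
  subst hglue
  rfl

/-- The functor `X ↦ (X at the vertex)` from `Aff(ℤ_p)`-sets to coverings of the witness.
[cite: MochizukiSemiAnbd2006, Def 3.5(i) p.37] -/
def affCovFunctor : BTemp (PadicAffine p) ⥤ CovObj (affWitness p) where
  obj X := affCovObj X
  map f := { fV := fun _ => f, fE := fun e => e.elim, comm := fun b => b.elim }
  map_id _ := CovHom.ext (funext fun _ => rfl) (funext fun e => e.elim)
  map_comp _ _ := CovHom.ext (funext fun _ => rfl) (funext fun e => e.elim)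

/-! ### Every covering of the witness is tempered -/

/-- In a `Π`-set, if a normal subgroup `N` fixes `x` then it fixes `g · x`. [folklore] -/
private theorem fixed_smul_of_normal {G : Type u} [Group G] [TopologicalSpace G] (N : Subgroup G)
    (hN : N.Normal) (X : BTemp G) (x : X.obj.V) (g : G) (hx : ∀ γ ∈ N, X.obj.ρ γ x = x) :
    ∀ γ ∈ N, X.obj.ρ γ (X.obj.ρ g x) = X.obj.ρ g x := by
  intro γ hγ
  have hc : g⁻¹ * γ * g⁻¹⁻¹ ∈ N := hN.conj_mem γ hγ g⁻¹
  rw [inv_inv] at hc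
  calc X.obj.ρ γ (X.obj.ρ g x)
      = X.obj.ρ (g * (g⁻¹ * γ * g)) x := by
        rw [← ρ_mul_apply]; congr 1; group
    _ = X.obj.ρ g x := by rw [ρ_mul_apply, hx _ hc]

/-- In a `Π`-set, a normal subgroup `N` fixes `x` iff it fixes `g · x`. [folklore] -/
private theorem fixed_iff_fixed_smul_of_normal {G : Type u} [Group G] [TopologicalSpace G]
    (N : Subgroup G) (hN : N.Normal) (X : BTemp G) (x : X.obj.V) (g : G) :
    (∀ γ ∈ N, X.obj.ρ γ x = x) ↔ ∀ γ ∈ N, X.obj.ρ γ (X.obj.ρ g x) = X.obj.ρ g x := by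
  refine ⟨fixed_smul_of_normal N hN X x g, fun h => ?_⟩
  have h' := fixed_smul_of_normal N hN X (X.obj.ρ g x) g⁻¹ h
  rwa [← ρ_mul_apply, inv_mul_cancel, ρ_one_apply] at h'

/-- The congruence subgroup `Γ_n` fixes the point `t` of the vertex fibre.
[cite: MochizukiSemiAnbd2006, Def 3.5(ii) p.37] -/
private def FixedByLevel (S : CovObj (affWitness p)) (n : ℕ) : S.Point → Prop
  | Sum.inl ⟨v, t⟩ => ∀ γ : (affWitness p).Gv v, γ ∈ PadicAffine.level p n → (S.SV v).obj.ρ γ t = t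
  | Sum.inr ⟨e, _⟩ => nomatch e

/-- `Γ_n`-fixedness is invariant along the adjacency relation generating the components (normality
of `Γ_n`). [cite: MochizukiSemiAnbd2006, Def 3.5(ii) p.37] -/
private theorem fixedByLevel_iff_of_adj (S : CovObj (affWitness p)) (n : ℕ) {a b : S.Point}
    (h : S.Adj a b) : FixedByLevel S n a ↔ FixedByLevel S n b := by
  cases h with
  | vertex v g x =>
    exact fixed_iff_fixed_smul_of_normal (G := (affWitness p).Gv v) (PadicAffine.level p n)
      (PadicAffine.level_normal n) (S.SV v) x g
  | edge e => exact nomatch e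
  | glue b => exact nomatch b

/-- `Γ_n`-fixedness is constant on connected components. [cite: MochizukiSemiAnbd2006, Def 3.5(ii) p.37] -/
private theorem fixedByLevel_iff_of_sameComponent (S : CovObj (affWitness p)) (n : ℕ)
    {a b : S.Point} (h : S.SameComponent a b) : FixedByLevel S n a ↔ FixedByLevel S n b := by
  induction h with
  | rel x y hxy => exact fixedByLevel_iff_of_adj S n hxy
  | refl x => exact Iff.rfl
  | symm x y _ ih => exact ih.symm
  | trans x y z _ _ ih₁ ih₂ => exact ih₁.trans ih₂

/-- **Every covering of the witness is tempered** (Def. 3.5 (ii)): the component of a point `t`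
is split by the finite covering `Aff(ℤ_p)/Γ_n` for any `Γ_n` inside the (open) stabiliser of `t`.
[cite: MochizukiSemiAnbd2006, Def 3.5(ii) p.37] -/
theorem isTempered_covObj_affWitness (S : CovObj (affWitness p)) : S.IsTempered := by
  intro q
  rcases q with ⟨v, t⟩ | ⟨e, _⟩
  · have h1 : (1 : PadicAffine p) ∈ {g : PadicAffine p | (S.SV v).obj.ρ g t = t} := ρ_one_apply _ t
    obtain ⟨n, -, hsub⟩ := PadicAffine.exists_level_subset ((S.SV v).property.2 t) h1
    have hq : FixedByLevel S n (Sum.inl ⟨v, t⟩) := fun γ hγ => hsub (a := γ) hγ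
    refine ⟨levelCov n, levelCov_isFinite n, levelCov_hasNonemptyFibres n, fun q hpq => ?_⟩
    have hq' := (fixedByLevel_iff_of_sameComponent S n hpq).mp hq
    rcases q with ⟨w, s⟩ | ⟨e, _⟩
    · intro x g hgx
      exact hq' g (mem_level_of_fix n x g hgx)
    · exact nomatch e
  · exact nomatch e

/-! ### `B^temp(affWitness p) ≌ B^temp(Aff(ℤ_p))` -/

/-- The functor `B^temp(Aff(ℤ_p)) ⥤ B^temp(affWitness p)`, `X ↦` the covering with vertex fibre `X`.
[cite: MochizukiSemiAnbd2006, Def 3.5(ii) p.37] -/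
def affExtend : BTemp (PadicAffine p) ⥤ BTempCat (affWitness p) :=
  ObjectProperty.lift _ affCovFunctor fun _ => isTempered_covObj_affWitness _

/-- The functor `B^temp(affWitness p) ⥤ B^temp(Aff(ℤ_p))`, `S ↦ S_v` (restriction to the vertex).
[cite: MochizukiSemiAnbd2006, Def 3.5(ii) p.37] -/
def affRestrict : BTempCat (affWitness p) ⥤ BTemp (PadicAffine p) :=
  ObjectProperty.ι _ ⋙ restrictV (affWitness p) PUnit.unit

/-- A tempered covering of the witness is (isomorphic, by identity maps, to) the covering with its
own vertex fibre. [cite: MochizukiSemiAnbd2006, Def 3.5(ii) p.37] -/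
def affUnitIso (S : BTempCat (affWitness p)) : S ≅ affExtend.obj (affRestrict.obj S) :=
  ObjectProperty.isoMk _
    { hom := { fV := fun v => 𝟙 (S.obj.SV v), fE := fun e => e.elim, comm := fun b => b.elim }
      inv := { fV := fun v => 𝟙 (S.obj.SV v), fE := fun e => e.elim, comm := fun b => b.elim }
      hom_inv_id := CovHom.ext (funext fun _ => Category.id_comp _) (funext fun e => e.elim)
      inv_hom_id := CovHom.ext (funext fun _ => Category.id_comp _) (funext fun e => e.elim) }

/-- **`B^temp(affWitness p) ≌ B^temp(Aff(ℤ_p))`** via `S ↦ S_v`: a tempered covering of the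
one-vertex edgeless semi-graph of anabelioids `B(Aff(ℤ_p))` IS a countable discrete continuous
`Aff(ℤ_p)`-set. [cite: MochizukiSemiAnbd2006, Prop 3.6(ii) p.38] -/
def affTemperedEquiv : BTempCat (affWitness p) ≌ BTemp (PadicAffine p) :=
  CategoryTheory.Equivalence.mk affRestrict affExtend
    (NatIso.ofComponents affUnitIso fun f => ObjectProperty.hom_ext _
      (CovHom.ext (funext fun v => by
          cases v; exact (Category.comp_id _).trans (Category.id_comp _).symm)
        (funext fun e => e.elim)))
    (NatIso.ofComponents (fun _ => Iso.refl _) fun _ => rfl)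

/-- The inverse of `affTemperedEquiv` is `affExtend` (definitionally).
[cite: MochizukiSemiAnbd2006, Prop 3.6(ii) p.38] -/
theorem affTemperedEquiv_inverse : (affTemperedEquiv (p := p)).inverse = affExtend := rfl

/-- The functor of `affTemperedEquiv` is the restriction to the vertex (definitionally).
[cite: MochizukiSemiAnbd2006, Prop 3.6(ii) p.38] -/
theorem affTemperedEquiv_functor : (affTemperedEquiv (p := p)).functor = affRestrict := rfl

/-! ### The explicit chart -/

/-- `Aff(ℤ_p)` is second countable (a subspace of `ℤ_p × ℤ_p`); [IUTchI] Rmk. 2.5.3 (i) (T6) asks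
`π₁^temp` to be Galois-countable. [cite: MochizukiSemiAnbd2006, Rmk 3.1.1 p.33] -/
theorem secondCountableTopology_padicAffine : SecondCountableTopology (PadicAffine p) :=
  PadicAffine.isEmbedding_coord.secondCountableTopology

variable (p) in
/-- **The explicit tempered fundamental group chart of the witness**: `π₁^temp(affWitness p)` may be
taken to be `Aff(ℤ_p)` itself, with `B^temp(affWitness p) ≌ B^temp(Aff(ℤ_p))` the restriction to
the vertex. [cite: MochizukiSemiAnbd2006, Prop 3.6(ii) p.38] -/
def affChart : TemperedPiChart (affWitness p) where
  G := PadicAffine p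
  isTempered := isTempered_padicAffine
  secondCountableTopology := secondCountableTopology_padicAffine
  equiv := affTemperedEquiv

/-- The group of the explicit chart is `Aff(ℤ_p)` (definitionally).
[cite: MochizukiSemiAnbd2006, Prop 3.6(ii) p.38] -/
theorem affChart_G : (affChart p).G = PadicAffine p := rfl

/-! ### The identity is a verticial homomorphism; `⊤` is a verticial subgroup -/

/-- `X ≅ B^temp(id)(X)` by the identity map. [cite: MochizukiSemiAnbd2006, Rmk 3.1.2 pp.33-34] -/
def resIdIso (X : BTemp (PadicAffine p)) :
    X ≅ (BTemp.res (ContinuousMonoidHom.id (PadicAffine p))).obj X where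
  hom := ObjectProperty.homMk
    { hom := TypeCat.ofHom fun x : X.obj.V => (x : X.obj.V)
      comm := fun g => by
        apply ConcreteCategory.hom_ext
        intro x
        rfl }
  inv := ObjectProperty.homMk
    { hom := TypeCat.ofHom fun x : X.obj.V => (x : X.obj.V)
      comm := fun g => by
        apply ConcreteCategory.hom_ext
        intro x
        rfl }
  hom_inv_id := hom_ext_apply fun _ => rfl
  inv_hom_id := hom_ext_apply fun _ => rfl

/-- For the explicit chart, `equiv.inverse ⋙ ι ⋙ restrictV` is (isomorphic by identity maps to)
`B^temp(id_{Aff(ℤ_p)})`. [cite: MochizukiSemiAnbd2006, Thm 3.7(i) p.40] -/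
def affChartRestrictIso :
    (affChart p).equiv.inverse ⋙ ObjectProperty.ι _ ⋙ restrictV (affWitness p) PUnit.unit ≅
      BTemp.res (ContinuousMonoidHom.id (PadicAffine p)) :=
  NatIso.ofComponents (fun X => resIdIso X) fun _ => hom_ext_apply fun _ => rfl

/-- **The identity of `Aff(ℤ_p)` is a verticial homomorphism** at the vertex, for the explicit
chart. [cite: MochizukiSemiAnbd2006, Thm 3.7(i) p.40] -/
theorem isVerticialHom_id_affChart (v : (affWitness p).graph.Vertex) :
    IsVerticialHom (affChart p) v (ContinuousMonoidHom.id (PadicAffine p)) :=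
  ⟨affChartRestrictIso⟩

/-- **The whole group `Aff(ℤ_p)` is a verticial subgroup** of `π₁^temp(affWitness p) = Aff(ℤ_p)`
(explicit chart). [cite: MochizukiSemiAnbd2006, Thm 3.7(i) p.40] -/
theorem top_mem_verticialSubgroups_affChart (v : (affWitness p).graph.Vertex) :
    (⊤ : Subgroup (PadicAffine p)) ∈ verticialSubgroups (affChart p) v := by
  refine ⟨ContinuousMonoidHom.id (PadicAffine p), ⟨affChartRestrictIso⟩, ?_⟩
  ext g
  simp only [Subgroup.mem_top, true_iff]
  exact ⟨g, rfl⟩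

/-- The verticial subgroups of the explicit chart at the vertex are nonempty — here by an explicit
element, `⊤`. [cite: MochizukiSemiAnbd2006, Thm 3.7(i) p.40] -/
theorem verticialSubgroups_affChart_nonempty (v : (affWitness p).graph.Vertex) :
    (verticialSubgroups (affChart p) v).Nonempty :=
  ⟨⊤, top_mem_verticialSubgroups_affChart v⟩

/-- **Every verticial homomorphism of the explicit chart is an inner automorphism of `Aff(ℤ_p)`**
(Prop. 3.2, injectivity half `ResIsoResIff_holds`, applied to `B^temp(φ) ≅ B^temp(id)`).
[cite: MochizukiSemiAnbd2006, Prop 3.2 p.35] -/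
theorem exists_conj_eq_of_isVerticialHom_affChart (v : (affWitness p).graph.Vertex)
    (φ : (affWitness p).Gv v →ₜ* (affChart p).G) (hφ : IsVerticialHom (affChart p) v φ) :
    ∃ g : PadicAffine p, ∀ x : PadicAffine p, g * x * g⁻¹ = φ x := by
  obtain ⟨e⟩ := hφ
  haveI : SecondCountableTopology (PadicAffine p) := secondCountableTopology_padicAffine
  exact (ResIsoResIff_holds (PadicAffine p) (PadicAffine p) isTempered_padicAffine
    isTempered_padicAffine (ContinuousMonoidHom.id (PadicAffine p)) φ).mp
      ⟨affChartRestrictIso.symm ≪≫ e⟩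

/-- **The verticial subgroups of the explicit chart are exactly `{Aff(ℤ_p)}`**: a verticial
homomorphism is an inner automorphism, so its range is everything.
[cite: MochizukiSemiAnbd2006, Thm 3.7(i) p.40] -/
theorem verticialSubgroups_affChart_eq (v : (affWitness p).graph.Vertex) :
    verticialSubgroups (affChart p) v = {⊤} := by
  ext H
  constructor
  · rintro ⟨φ, hφ, rfl⟩
    obtain ⟨g, hg⟩ := exists_conj_eq_of_isVerticialHom_affChart v φ hφ
    rw [Set.mem_singleton_iff, eq_top_iff]
    intro y _
    obtain ⟨y, rfl⟩ : ∃ y' : PadicAffine p, y' = y := ⟨y, rfl⟩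
    refine ⟨g⁻¹ * y * g, ?_⟩
    change φ (g⁻¹ * y * g) = y
    rw [← hg]
    group
  · rintro rfl
    exact top_mem_verticialSubgroups_affChart v

end ProfiniteSemiGraph

end Literature.AnabelianGeometry.SemiGraphs

end
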